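import Summits.BirchSwinnertonDyer.BirchSwinnertonDyer.Theorems.KatoDescentPotSupersingularFineSelmerDescentBigImage
import Summits.BirchSwinnertonDyer.BirchSwinnertonDyer.Theorems.CongruentShaFreeCutIntegralH1RankLeOne
import Literature.NumberTheory.EllipticCurves.Kato2004.FineSelmerDualTorsionOfEulerSystemBoundProofs
import Literature.NumberTheory.EllipticCurves.Kato2004.IwasawaH2FineSelmerDualComparison
import HarnessLib

/-!
# Line `kato_Fframe` (crux `ErratumRoadFive.EulerHalfNotRamNoInertSetAtFive`, stmt-BirchSwinnertonDyer-19715; registered skeleton r5.2 `Lines/kato_Fframe_r5.lean` cf457b9468bcf978), stub S1Λ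
# `stub_katoLambdaLogBoundTamagawa` — sub-lemma **P1 (Λ-II in RANK ONE)**: the bsd-potss fine descent theorem
# `FineSelmerDescentOfDivisibility.natCard_fineSelmer_invariants_mul_descentCokernel_dvd_of_charIdeal_le'` WITHOUT the
# rank-0 instance `[Finite W.toAffine.Point]`, and its P1′ corollary `#Sel₀(W/ℚ_∞)^Γ ∣ [H¹(ℤ[1/p],T_pW) : ℤ_p s₀]`
# (PROOF WORKFILE — sorry-free; planner bsd-idea-9 g40, lens = complete; answers critic V287 P3)

Crux workfile (`Cruxes/EulerHalfNotRamNoInertSetAtFive/Lines/`), published by `ledger crux write` only; NOT a registration,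
NOT a `Theorems/` proposal (the pen / the summoned width decides whether to lift it, as for the S2 workfiles). Companion of the
stage-1 inventory `Lines/kato_Fframe_r5_S1Lambda.md` (rev 2, §3 P1 / §4 step 1). HONEST FRAMING: no summit statement, crux
or registered stub is proved here; S1Λ is NOT proved here (this is its first sub-lemma, the `Γ`-Euler-characteristic descent);
BSD is proved for no curve.

## What is proved (everything a theorem; no `def`, no named fact, no `sorry`)

On a RANK-ONE row — `W.mordellWeilRank = 1` and `Ш(W)[p^∞]` finite (for S1Λ: ⟸ `r_an = 1` by GZK, S0) — with the cyclotomic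
`(κ, γ)`, a pinned `I : IwasawaH1Data W p κ γ` (`𝐇¹_Γ(T_pW)`), ANY dual fine Selmer datum `Y` and ANY class `s ∈ 𝐇¹_Γ` whose
bottom layer `proj₀ s` has infinite order:

* §1 the PIN lemmas of `Theorems.ReducibleFineSelmerDescentCount` (rkm g16) and the torsion lemma of
  `Theorems.ReducibleZetaDivisibility` — the TWO places where (R0) enters — with `[Finite W.toAffine.Point]` (R0) replaced by (R1) = `Theorems.CongruentShaFreeCutIntegralH1RankLeOne.rank_integralH1_layerZero_le_one` (bsd-cn100 s2-c3,
  PROVED: `rank_{ℤ_p} H¹(ℤ[1/p],T_pW) ≤ 1` in rank one with `Ш[p^∞]` finite):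
  `finite_quotient_span_of_rankOne` (`H¹(ℤ[1/p],T_pW)/ℤ_p s₀` finite), `finite_coinvariants_quotient_span_of_rankOne`
  (`(𝐇¹_Γ/T)/Λs̄`, `(𝐇¹_Γ/Λs)/T` finite), `finite_descentCokernel_of_rankOne` (`H¹(ℤ[1/p],T_pW)/proj₀(𝐇¹_Γ/T)` finite), `isTorsion_quotient_span_singleton_of_rankOne`
  (`𝐇¹_Γ/Λy` torsion for `y ≠ 0`: (R1) + (R2) `IwasawaH1Data.rank_le_one_of_rank_integralH1_le_one`).
* §2 **P1** `natCard_fineSelmer_invariants_mul_descentCokernel_dvd_of_charIdeal_le_of_rankOne`: from `X₀ = Y.X` torsion and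
  `char_Λ(𝐇¹_Γ/Λs) ⊆ char_Λ X₀`:
  `#Sel₀(W/ℚ_∞)^Γ · #(H¹(ℤ[1/p],T_pW)/proj₀(𝐇¹_Γ/T)) ∣ #Sel₀(W/ℚ_∞)_Γ · [H¹(ℤ[1/p],T_pW) : ℤ_p s₀]`, all four finite —
  the §1 theorem of `KatoDescentPotSupersingularFineSelmerDescentBigImage.lean` VERBATIM in rank one (same proof, R0 ↦ R1).
  `…_of_lengthAt_le_of_rankOne`: the same from the LENGTH inequality `ℓ_𝔭(X₀) ≤ ℓ_𝔭(𝐇¹_Γ/Λs)` at every height-one `𝔭`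
  (the shape of the inventory's named fact F1′ = Kato Thm. 12.5 (4) for an admissible `z₀`), via
  `Kim2025.charIdeal_le_charIdeal_of_lengthAt_le` and torsion of `X₀` read off at `𝔭 = (T)`
  (`IwasawaAlgebra.isTorsion_of_lengthAt_primeT_ne_top`, the k8q-c2x g7 pattern).
* §3 **P1′** `natCard_fineSelmer_invariants_dvd_index_of_rankOne`: with a descent package `J : IwasawaH2Data W p κ γ I` and an
  INJECTIVE `Λ`-linear `e : Y.X → J.H2` (the shape delivered by the comparison fact
  `Kato2004.exists_iwasawaH2Data_fineSelmerDual_embedding` for the constructed datum, `p` odd, `W(ℚ_{p,∞})[p^∞]` finite):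
  `#Sel₀(W/ℚ_∞)_Γ = #X₀[T] ∣ #𝐇²_Γ[T] = #(H¹(ℤ[1/p],T_pW)/proj₀(𝐇¹_Γ/T))` (`IwasawaH2Data.descentCokernelEquiv`), hence
  **`#Sel₀(W/ℚ_∞)^Γ ∣ [H¹(ℤ[1/p],T_pW) : ℤ_p s₀]`**; and `…_of_embedding_fact` = the same with the comparison FACT as a
  hypothesis binder and `Y :=` the constructed `W.fineSelmerDualData κ hγ`.

For S1Λ this is move Λ-II (+ the `#desc ≥ #X₀[T]` half of Λ-III) of `Lines/kato_Fframe_r4_LambdaTAM.md` / the inventory §1: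
what remains there is Λ-I (the fact F1′), Λ-III's index `[H¹(ℤ[1/p],T_pW) : ℤ_p s₀] = p^{vt − vx − ε}` and Λ-IV (level-0 fine
control with the local kernels `c_ℓ^{(p)}`, `#W(ℚ_p)[p^∞]`).

References: [Kato2004Asterisque] Thm. 12.4 (1) (p. 221), Thm. 12.5 (4) (p. 222), Thm. 14.5 (p. 236), §14.14 (14.14.1) and
Lemma 14.15 (pp. 243–244); [GreenbergLNM1716] §4 Lemma 4.2 (p. 102); tree files named above.
-/

-- the summit and its single problem are both named `BirchSwinnertonDyer` (registry layout D-0017)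
set_option linter.dupNamespace false
set_option autoImplicit false

noncomputable section

open scoped NumberField
open Field IsDedekindDomain WeierstrassCurve
open Literature.NumberTheory.GaloisRepresentations Literature.NumberTheory.EllipticCurves
open Literature.NumberTheory.EllipticCurves.GreenbergSelmer
open Literature.NumberTheory.EllipticCurves.Kato2004 Literature.NumberTheory.EllipticCurves.Kato2004.EulerSystemValues
open Literature.NumberTheory.EllipticCurves.IwasawaAlgebra Literature.NumberTheory.EllipticCurves.IwasawaDual

namespace Summit.BirchSwinnertonDyer.BirchSwinnertonDyer.Cruxes.EulerHalfNotRamNoInertSetAtFive.KatoFframe.P1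

/-! ## §1 The pin lemmas in rank one ((R0) ↦ (R1)) -/

section Pin

variable {W : WeierstrassCurve ℚ} [W.IsElliptic] {p : ℕ} [Fact p.Prime]
  [ContinuousSMul ℤ_[p] (W.tateModule p)] {κ : ZpExtension ℚ p} {γ : absoluteGaloisGroup ℚ}

/-- **Rank one: if `y₀ = proj₀ y` has infinite order then `H¹(ℤ[1/p],T_pW)/ℤ_p y₀` is finite** — (R1)
`rank_{ℤ_p} H¹(ℤ[1/p],T_pW) ≤ 1` (`CongruentShaFreeCutIntegralH1RankLeOne.rank_integralH1_layerZero_le_one`, from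
`rank W(ℚ) = 1` and `Ш(W)[p^∞]` finite) and `IntegralH1RankZero.finite_quotient_of_rank_le_one`; the rank-0 twin is
`ReducibleFineSelmerDescentCount.finite_quotient_span_of_not_isOfFinAddOrder`.
[cite: Kato2004Asterisque, 14.13 (p. 243) and Thm. 14.5 (1)–(2) (p. 236)] -/
theorem finite_quotient_span_of_rankOne (hrank : W.mordellWeilRank = 1)
    [Finite (AddCommGroup.primaryComponent W.sha p)] (I : IwasawaH1Data W p κ γ) (y : I.H)
    (hnt : ¬ IsOfFinAddOrder (I.proj 0 y)) :
    Finite (integralH1 (tateRep W p) p (κ.layerSubgroup 0) ⧸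
        Submodule.span ℤ_[p] {(⟨I.proj 0 y, I.proj_mem 0 y⟩ : integralH1 (tateRep W p) p (κ.layerSubgroup 0))}) := by
  haveI := module_finite_integralH1_layerZero W p κ
  refine Theorems.IntegralH1RankZero.finite_quotient_of_rank_le_one p
    (Theorems.CongruentShaFreeCutIntegralH1RankLeOne.rank_integralH1_layerZero_le_one W p κ hrank) _
    (Submodule.mem_span_singleton_self _) fun h ↦ hnt ?_
  obtain ⟨n, hn, hny⟩ := h.exists_nsmul_eq_zero
  exact isOfFinAddOrder_iff_nsmul_eq_zero.mpr ⟨n, hn, by simpa using congrArg Subtype.val hny⟩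

/-- **Rank one: `(𝐇¹_Γ/T)/Λȳ` and `(𝐇¹_Γ/Λy)/T` are finite when `proj₀ y` has infinite order** (`κ` cyclotomic, `γ` a
topological generator) — the injection `ReducibleFineSelmerDescentCount.natCard_coinvariants_quotient_span_dvd_index`
(rank-free) into the finite `H¹(ℤ[1/p],T_pW)/ℤ_p y₀` of `finite_quotient_span_of_rankOne`.
[cite: Kato2004Asterisque, §14.14 (14.14.1) (p. 243), Thm. 14.5 (2) (p. 236)] -/
theorem finite_coinvariants_quotient_span_of_rankOne (hrank : W.mordellWeilRank = 1)
    [Finite (AddCommGroup.primaryComponent W.sha p)] (hκ : κ.IsCyclotomic) (hγ : κ.IsTopGenerator γ)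
    (I : IwasawaH1Data W p κ γ) (y : I.H) (hnt : ¬ IsOfFinAddOrder (I.proj 0 y)) :
    Finite (coinvariants p I.H ⧸
        Submodule.span (IwasawaAlgebra p) {(Submodule.Quotient.mk y : coinvariants p I.H)}) ∧
      Finite (coinvariants p (I.H ⧸ Submodule.span (IwasawaAlgebra p) {y})) := by
  haveI := finite_quotient_span_of_rankOne hrank I y hnt
  have hne : Nat.card (integralH1 (tateRep W p) p (κ.layerSubgroup 0) ⧸
      Submodule.span ℤ_[p] {(⟨I.proj 0 y, I.proj_mem 0 y⟩ :
        integralH1 (tateRep W p) p (κ.layerSubgroup 0))}) ≠ 0 := Nat.card_pos.ne'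
  have hdvd := Theorems.ReducibleFineSelmerDescentCount.natCard_coinvariants_quotient_span_dvd_index hκ hγ I y
  have h1 : Nat.card (coinvariants p I.H ⧸
      Submodule.span (IwasawaAlgebra p) {(Submodule.Quotient.mk y : coinvariants p I.H)}) ≠ 0 :=
    fun h0 ↦ hne (Nat.eq_zero_of_zero_dvd (h0 ▸ hdvd))
  have h2 : Nat.card (coinvariants p (I.H ⧸ Submodule.span (IwasawaAlgebra p) {y})) ≠ 0 := by
    rw [Kato2004.natCard_coinvariants_quotient_span y]; exact h1
  exact ⟨Nat.finite_of_card_ne_zero h1, Nat.finite_of_card_ne_zero h2⟩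

/-- **Rank one: `H¹(ℤ[1/p],T_pW)/proj₀(𝐇¹_Γ/T)` (the descent cokernel, `≅ 𝐇²_Γ[T]` on a descent package) is finite
when `proj₀ y` has infinite order** — a quotient of the finite `H¹(ℤ[1/p],T_pW)/ℤ_p y₀`
(`ReducibleFineSelmerDescentCount.natCard_quotient_span_eq_natCard_descentCokernel_mul`, rank-free).
[cite: Kato2004Asterisque, Thm. 14.5 (1) (p. 236), §14.14 (14.14.1) (p. 243)] -/
theorem finite_descentCokernel_of_rankOne (hrank : W.mordellWeilRank = 1)
    [Finite (AddCommGroup.primaryComponent W.sha p)] (hκ : κ.IsCyclotomic) (hγ : κ.IsTopGenerator γ)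
    (I : IwasawaH1Data W p κ γ) (y : I.H) (hnt : ¬ IsOfFinAddOrder (I.proj 0 y)) :
    Finite I.descentCokernel := by
  haveI := finite_quotient_span_of_rankOne hrank I y hnt
  have hne : Nat.card (integralH1 (tateRep W p) p (κ.layerSubgroup 0) ⧸
      Submodule.span ℤ_[p] {(⟨I.proj 0 y, I.proj_mem 0 y⟩ :
        integralH1 (tateRep W p) p (κ.layerSubgroup 0))}) ≠ 0 := Nat.card_pos.ne'
  rw [Theorems.ReducibleFineSelmerDescentCount.natCard_quotient_span_eq_natCard_descentCokernel_mul hκ hγ I y] at hne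
  exact Nat.finite_of_card_ne_zero (left_ne_zero_of_mul hne)

/-- **Rank one: `𝐇¹_Γ(T_pW)/Λy` is torsion for `y ≠ 0`** (`κ` cyclotomic, `γ` a topological generator): `𝐇¹_Γ` is
finitely generated (12.2.1), torsion free, and of `Λ`-rank `≤ 1` by (R1) + (R2)
(`IwasawaH1Data.rank_le_one_of_rank_integralH1_le_one`); the rank-0 twin is
`ReducibleZetaDivisibility.isTorsion_quotient_span_singleton_of_ne_zero` — the SECOND place where (R0) enters §1 of
`KatoDescentPotSupersingularFineSelmerDescentBigImage.lean`. [cite: Kato2004Asterisque, Thm. 12.4 (2) (p. 221), Thm. 14.5 (1) (p. 236)] -/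
theorem isTorsion_quotient_span_singleton_of_rankOne (hrank : W.mordellWeilRank = 1)
    [Finite (AddCommGroup.primaryComponent W.sha p)] (hκ : κ.IsCyclotomic) (hγ : κ.IsTopGenerator γ)
    (I : IwasawaH1Data W p κ γ) {y : I.H} (hy0 : y ≠ 0) :
    Module.IsTorsion (IwasawaAlgebra p) (I.H ⧸ Submodule.span (IwasawaAlgebra p) {y}) := by
  haveI := IwasawaH1Data.module_finite_of_isCyclotomic hκ hγ I
  haveI := I.noZeroSMulDivisors hγ
  exact Theorems.MemberHullRankOne.isTorsion_quotient_span_singleton_of_rank_le_one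
    (hF := IwasawaH1Data.rank_le_one_of_rank_integralH1_le_one hκ hγ I
      (Theorems.CongruentShaFreeCutIntegralH1RankLeOne.rank_integralH1_layerZero_le_one W p κ hrank)) (hz := hy0)

end Pin

/-! ## §2 P1: the fine descent divisibility in rank one -/

section Descent

variable (W : WeierstrassCurve ℚ) [W.IsElliptic] (p : ℕ) [Fact p.Prime]
  [ContinuousSMul ℤ_[p] (W.tateModule p)] [Finite (AddCommGroup.primaryComponent W.sha p)]
  {κ : ZpExtension ℚ p} {γ : absoluteGaloisGroup ℚ}

/-- **P1 — descent of `char_Λ(𝐇¹_Γ/Λs) ⊆ char_Λ X₀` to the `Γ`-(co)invariants in RANK ONE**: for `rank W(ℚ) = 1`,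
`Ш(W)[p^∞]` finite, the cyclotomic `(κ, γ)`, a pinned `I`, any dual fine Selmer datum `Y` with `X₀ = Y.X` torsion, any
`s ∈ 𝐇¹_Γ(T_pW)` with `proj₀ s` of infinite order, and the divisibility `char_Λ(𝐇¹_Γ/Λs) ⊆ char_Λ X₀`:
`Sel₀(W/ℚ_∞)^Γ`, `Sel₀(W/ℚ_∞)_Γ`, the descent cokernel and `H¹(ℤ[1/p],T_pW)/ℤ_p s₀` are finite and
`#Sel₀(W/ℚ_∞)^Γ · #(H¹(ℤ[1/p],T_pW)/proj₀(𝐇¹_Γ/T)) ∣ #Sel₀(W/ℚ_∞)_Γ · [H¹(ℤ[1/p],T_pW) : ℤ_p s₀]`.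
Proof = `FineSelmerDescentOfDivisibility.natCard_fineSelmer_invariants_mul_descentCokernel_dvd_of_charIdeal_le'` with the
four rank-0 (R0) call sites replaced by the (R1) lemmas of §1. [cite: Kato2004Asterisque, Thm. 14.5 (3) (p. 236), §14.14 and Lemma 14.15 (pp. 243–244)]
[cite: GreenbergLNM1716, §4 Lemma 4.2 (p. 102)] -/
theorem natCard_fineSelmer_invariants_mul_descentCokernel_dvd_of_charIdeal_le_of_rankOne
    (hrank : W.mordellWeilRank = 1) (hκ : κ.IsCyclotomic) (hγ : κ.IsTopGenerator γ) (I : IwasawaH1Data W p κ γ)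
    (Y : W.FineSelmerDualData κ γ) (hYtors : Module.IsTorsion (IwasawaAlgebra p) Y.X) (s : I.H)
    (hnt : ¬ IsOfFinAddOrder (I.proj 0 s))
    (hchar : Module.charIdeal (IwasawaAlgebra p) (I.H ⧸ Submodule.span (IwasawaAlgebra p) {s}) ≤
      Module.charIdeal (IwasawaAlgebra p) Y.X) :
    Finite (endInvariants (W.conjFineSelmerInfty κ γ - 1)) ∧
      Finite (EndCoinvariants (W.conjFineSelmerInfty κ γ - 1)) ∧ Finite I.descentCokernel ∧
      Finite (integralH1 (tateRep W p) p (κ.layerSubgroup 0) ⧸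
        Submodule.span ℤ_[p] {(⟨I.proj 0 s, I.proj_mem 0 s⟩ : integralH1 (tateRep W p) p (κ.layerSubgroup 0))}) ∧
      Nat.card (endInvariants (W.conjFineSelmerInfty κ γ - 1)) * Nat.card I.descentCokernel ∣
        Nat.card (EndCoinvariants (W.conjFineSelmerInfty κ γ - 1)) *
          Nat.card (integralH1 (tateRep W p) p (κ.layerSubgroup 0) ⧸
            Submodule.span ℤ_[p] {(⟨I.proj 0 s, I.proj_mem 0 s⟩ :
              integralH1 (tateRep W p) p (κ.layerSubgroup 0))}) := by
  have hs0 : s ≠ 0 := by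
    rintro rfl
    exact hnt (by rw [map_zero]; exact isOfFinAddOrder_iff_nsmul_eq_zero.mpr ⟨1, one_pos, by simp⟩)
  haveI : Module.Finite (IwasawaAlgebra p) I.H := IwasawaH1Data.module_finite_of_isCyclotomic hκ hγ I
  haveI := I.noZeroSMulDivisors hγ
  have htors : Module.IsTorsion (IwasawaAlgebra p) (I.H ⧸ Submodule.span (IwasawaAlgebra p) {s}) :=
    isTorsion_quotient_span_singleton_of_rankOne hrank hκ hγ I hs0
  haveI : Module.Finite (IwasawaAlgebra p) Y.X := FineSelmerDualData.module_finite W κ hγ Y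
  obtain ⟨-, hfinN⟩ := finite_coinvariants_quotient_span_of_rankOne hrank hκ hγ I s hnt
  obtain ⟨hiM, hcM, hiN⟩ := finite_coinvariants_of_charIdeal_le hYtors htors hchar hfinN
  have hdvd := natCard_coinvariants_mul_dvd_of_charIdeal_le hYtors htors hchar hfinN
  rw [Kato2004.natCard_invariants_quotient_span_eq_one s hs0 hiN, mul_one,
    Kato2004.natCard_coinvariants_quotient_span s] at hdvd
  have hD := Y.isDualPair hγ
  refine ⟨hD.finite_coinvariants_iff.mp hcM, hD.finite_invariants_iff.mp hiM,
    finite_descentCokernel_of_rankOne hrank hκ hγ I s hnt, finite_quotient_span_of_rankOne hrank I s hnt, ?_⟩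
  rw [hD.natCard_coinvariants, hD.natCard_invariants] at hdvd
  rw [Theorems.ReducibleFineSelmerDescentCount.natCard_quotient_span_eq_natCard_descentCokernel_mul hκ hγ I s,
    mul_left_comm _ (Nat.card I.descentCokernel), mul_comm _ (Nat.card I.descentCokernel)]
  exact mul_dvd_mul_left _ hdvd

/-- **P1 from the LENGTH inequality** (the shape of the S1Λ inventory's named fact F1′ = Kato Thm. 12.5 (4) for an admissible
zeta class, read on `X₀`): `ℓ_𝔭(X₀) ≤ ℓ_𝔭(𝐇¹_Γ/Λs)` at EVERY height-one prime `𝔭` implies `X₀` torsion (at `𝔭 = (T)`: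
`IwasawaAlgebra.isTorsion_of_lengthAt_primeT_ne_top`) and `char_Λ(𝐇¹_Γ/Λs) ⊆ char_Λ X₀`
(`Kim2025.charIdeal_le_charIdeal_of_lengthAt_le`), hence the conclusion of P1.
[cite: Kato2004Asterisque, Thm. 12.5 (4) (p. 222), Thm. 14.5 (3) (p. 236), §14.14 (pp. 243–244)] -/
theorem natCard_fineSelmer_invariants_mul_descentCokernel_dvd_of_lengthAt_le_of_rankOne
    (hrank : W.mordellWeilRank = 1) (hκ : κ.IsCyclotomic) (hγ : κ.IsTopGenerator γ) (I : IwasawaH1Data W p κ γ)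
    (Y : W.FineSelmerDualData κ γ) (s : I.H) (hnt : ¬ IsOfFinAddOrder (I.proj 0 s))
    (hlen : ∀ 𝔭 : PrimeSpectrum (IwasawaAlgebra p), 𝔭.asIdeal.height = 1 →
      Module.lengthAt (IwasawaAlgebra p) Y.X 𝔭 ≤
        Module.lengthAt (IwasawaAlgebra p) (I.H ⧸ Submodule.span (IwasawaAlgebra p) {s}) 𝔭) :
    Finite (endInvariants (W.conjFineSelmerInfty κ γ - 1)) ∧
      Finite (EndCoinvariants (W.conjFineSelmerInfty κ γ - 1)) ∧ Finite I.descentCokernel ∧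
      Finite (integralH1 (tateRep W p) p (κ.layerSubgroup 0) ⧸
        Submodule.span ℤ_[p] {(⟨I.proj 0 s, I.proj_mem 0 s⟩ : integralH1 (tateRep W p) p (κ.layerSubgroup 0))}) ∧
      Nat.card (endInvariants (W.conjFineSelmerInfty κ γ - 1)) * Nat.card I.descentCokernel ∣
        Nat.card (EndCoinvariants (W.conjFineSelmerInfty κ γ - 1)) *
          Nat.card (integralH1 (tateRep W p) p (κ.layerSubgroup 0) ⧸
            Submodule.span ℤ_[p] {(⟨I.proj 0 s, I.proj_mem 0 s⟩ :
              integralH1 (tateRep W p) p (κ.layerSubgroup 0))}) := by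
  have hs0 : s ≠ 0 := by
    rintro rfl
    exact hnt (by rw [map_zero]; exact isOfFinAddOrder_iff_nsmul_eq_zero.mpr ⟨1, one_pos, by simp⟩)
  haveI : Module.Finite (IwasawaAlgebra p) I.H := IwasawaH1Data.module_finite_of_isCyclotomic hκ hγ I
  haveI := I.noZeroSMulDivisors hγ
  have htors : Module.IsTorsion (IwasawaAlgebra p) (I.H ⧸ Submodule.span (IwasawaAlgebra p) {s}) :=
    isTorsion_quotient_span_singleton_of_rankOne hrank hκ hγ I hs0
  haveI : Module.Finite (IwasawaAlgebra p) Y.X := FineSelmerDualData.module_finite W κ hγ Y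
  -- `X₀` is torsion: finite length at `(T)`
  have hH : Module.lengthAt (IwasawaAlgebra p) (I.H ⧸ Submodule.span (IwasawaAlgebra p) {s}) (primeT p) ≠ ⊤ :=
    lengthAt_primeT_ne_top _ htors
  have hYtors : Module.IsTorsion (IwasawaAlgebra p) Y.X :=
    IwasawaAlgebra.isTorsion_of_lengthAt_primeT_ne_top Y.X
      (ne_top_of_le_ne_top hH (hlen (primeT p) (height_primeT p)))
  have hchar : Module.charIdeal (IwasawaAlgebra p) (I.H ⧸ Submodule.span (IwasawaAlgebra p) {s}) ≤
      Module.charIdeal (IwasawaAlgebra p) Y.X :=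
    Kim2025.charIdeal_le_charIdeal_of_lengthAt_le htors hYtors hlen
  exact natCard_fineSelmer_invariants_mul_descentCokernel_dvd_of_charIdeal_le_of_rankOne W p hrank hκ hγ I Y hYtors s
    hnt hchar

end Descent

/-! ## §3 P1′: `#Sel₀(W/ℚ_∞)^Γ ∣ [H¹(ℤ[1/p],T_pW) : ℤ_p s₀]` through the comparison `X₀ ↪ 𝐇²_Γ` -/

section Index

variable (W : WeierstrassCurve ℚ) [W.IsElliptic] (p : ℕ) [Fact p.Prime]
  [ContinuousSMul ℤ_[p] (W.tateModule p)] [Finite (AddCommGroup.primaryComponent W.sha p)]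
  {κ : ZpExtension ℚ p} {γ : absoluteGaloisGroup ℚ}

/-- `#X₀[T] ∣ #𝐇²_Γ[T]` for an injective `Λ`-linear `e : X₀ → 𝐇²_Γ` (restriction of `e` to the `T`-torsion; `Nat.card`, so
`0 ∣ 0` when both are infinite). [folklore] -/
theorem natCard_invariants_dvd_of_injective {X H : Type*} [AddCommGroup X] [_root_.Module (IwasawaAlgebra p) X]
    [AddCommGroup H] [_root_.Module (IwasawaAlgebra p) H] (e : X →ₗ[IwasawaAlgebra p] H)
    (he : Function.Injective e) : Nat.card (invariants p X) ∣ Nat.card (invariants p H) := by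
  let f : invariants p X →+ invariants p H :=
    { toFun := fun x ↦ ⟨e (x : X), by
        have hx := x.2
        rw [IwasawaAlgebra.mem_invariants_iff] at hx ⊢
        rw [← map_smul, hx, map_zero]⟩
      map_zero' := Subtype.ext (by simp)
      map_add' := fun x y ↦ Subtype.ext (by simp) }
  have hf : Function.Injective f := fun x y hxy ↦
    Subtype.ext (he (congrArg Subtype.val hxy))
  exact AddSubgroup.card_dvd_of_injective f hf

/-- **P1′ — `#Sel₀(W/ℚ_∞)^Γ ∣ [H¹(ℤ[1/p],T_pW) : ℤ_p s₀]` in rank one.** Hypotheses of P1 plus a descent package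
`J : IwasawaH2Data W p κ γ I` and an injective `Λ`-linear `e : Y.X → J.H2` (`X₀ ↪ 𝐇²_Γ`). Then
`#Sel₀(W/ℚ_∞)_Γ = #X₀[T]` (`FineSelmerDualData.isDualPair`) divides `#𝐇²_Γ[T] = #desc` (`IwasawaH2Data.descentCokernelEquiv`),
and P1's `#Sel₀^Γ · #desc ∣ #(Sel₀)_Γ · [A : ℤ_p s₀]` collapses to the displayed divisibility.
[cite: Kato2004Asterisque, Thm. 14.5 (3) (p. 236), §14.14 (14.14.1) (p. 243)] -/
theorem natCard_fineSelmer_invariants_dvd_index_of_rankOne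
    (hrank : W.mordellWeilRank = 1) (hκ : κ.IsCyclotomic) (hγ : κ.IsTopGenerator γ) (I : IwasawaH1Data W p κ γ)
    (J : IwasawaH2Data W p κ γ I) (Y : W.FineSelmerDualData κ γ) (e : Y.X →ₗ[IwasawaAlgebra p] J.H2)
    (he : Function.Injective e) (hYtors : Module.IsTorsion (IwasawaAlgebra p) Y.X) (s : I.H)
    (hnt : ¬ IsOfFinAddOrder (I.proj 0 s))
    (hchar : Module.charIdeal (IwasawaAlgebra p) (I.H ⧸ Submodule.span (IwasawaAlgebra p) {s}) ≤
      Module.charIdeal (IwasawaAlgebra p) Y.X) :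
    Nat.card (endInvariants (W.conjFineSelmerInfty κ γ - 1)) ∣
      Nat.card (integralH1 (tateRep W p) p (κ.layerSubgroup 0) ⧸
        Submodule.span ℤ_[p] {(⟨I.proj 0 s, I.proj_mem 0 s⟩ : integralH1 (tateRep W p) p (κ.layerSubgroup 0))}) := by
  obtain ⟨-, hfc, hfd, -, hdvd⟩ :=
    natCard_fineSelmer_invariants_mul_descentCokernel_dvd_of_charIdeal_le_of_rankOne W p hrank hκ hγ I Y hYtors s hnt hchar
  have hD := Y.isDualPair hγ
  -- `#(Sel₀)_Γ = #X₀[T] ∣ #𝐇²[T] = #desc`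
  have hb : Nat.card (EndCoinvariants (W.conjFineSelmerInfty κ γ - 1)) ∣ Nat.card I.descentCokernel := by
    rw [← hD.natCard_invariants, Nat.card_congr J.descentCokernelEquiv.toEquiv]
    exact natCard_invariants_dvd_of_injective p e he
  obtain ⟨k, hk⟩ := hb
  have hbpos : 0 < Nat.card (EndCoinvariants (W.conjFineSelmerInfty κ γ - 1)) := by
    haveI := hfc
    exact Nat.card_pos
  -- `a·(b·k) ∣ b·c` with `b > 0` gives `a·k ∣ c`, hence `a ∣ c`
  rw [hk, mul_left_comm] at hdvd
  exact (dvd_mul_right _ k).trans (Nat.dvd_of_mul_dvd_mul_left hbpos hdvd)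

/-- **P1′ with the comparison FACT as a binder, on the constructed datum `X₀(W/ℚ_∞) = (W.fineSelmerDualData κ hγ).X`**:
for `p` odd, `κ` cyclotomic, `W(ℚ_{p,∞})[p^∞]` finite (always the case at a multiplicative `p`, `p` odd), rank one and
`Ш[p^∞]` finite, every pinned `I` and every `s ∈ 𝐇¹_Γ(T_pW)` with `proj₀ s` of infinite order and
`ℓ_𝔭(X₀) ≤ ℓ_𝔭(𝐇¹_Γ/Λs)` at every height-one `𝔭`: **`#Sel₀(W/ℚ_∞)^Γ ∣ [H¹(ℤ[1/p],T_pW) : ℤ_p s₀]`**, CONDITIONAL on the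
named fact `Kato2004.exists_iwasawaH2Data_fineSelmerDual_embedding`.
[cite: Kato2004Asterisque, (14.9.1) (p. 239), Thm. 12.5 (4) (p. 222), Thm. 14.5 (3) (p. 236), §14.14 (pp. 243–244)] -/
theorem natCard_fineSelmer_invariants_dvd_index_of_lengthAt_le_of_rankOne_of_embedding_fact
    (hX : exists_iwasawaH2Data_fineSelmerDual_embedding) (hp : p ≠ 2)
    (hrank : W.mordellWeilRank = 1) (hκ : κ.IsCyclotomic) (hγ : κ.IsTopGenerator γ) (v : HeightOneSpectrum (𝓞 ℚ))
    (hv : ((Rat.HeightOneSpectrum.primesEquiv v : Nat.Primes) : ℕ) = p)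
    (hfin : Finite (FixedPoints.addSubgroup ↥(κ.kerSubgroup ⊓ GreenbergSelmer.decomp v) (W.geomPrimaryTorsion p)))
    (I : IwasawaH1Data W p κ γ) (s : I.H) (hnt : ¬ IsOfFinAddOrder (I.proj 0 s))
    (hlen : ∀ 𝔭 : PrimeSpectrum (IwasawaAlgebra p), 𝔭.asIdeal.height = 1 →
      Module.lengthAt (IwasawaAlgebra p) (W.fineSelmerDualData κ hγ).X 𝔭 ≤
        Module.lengthAt (IwasawaAlgebra p) (I.H ⧸ Submodule.span (IwasawaAlgebra p) {s}) 𝔭) :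
    Nat.card (endInvariants (W.conjFineSelmerInfty κ γ - 1)) ∣
      Nat.card (integralH1 (tateRep W p) p (κ.layerSubgroup 0) ⧸
        Submodule.span ℤ_[p] {(⟨I.proj 0 s, I.proj_mem 0 s⟩ : integralH1 (tateRep W p) p (κ.layerSubgroup 0))}) := by
  obtain ⟨J, e, he, -⟩ := hX W p κ γ hγ v hp hκ hv hfin I
  have hs0 : s ≠ 0 := by
    rintro rfl
    exact hnt (by rw [map_zero]; exact isOfFinAddOrder_iff_nsmul_eq_zero.mpr ⟨1, one_pos, by simp⟩)
  haveI : Module.Finite (IwasawaAlgebra p) I.H := IwasawaH1Data.module_finite_of_isCyclotomic hκ hγ I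
  haveI := I.noZeroSMulDivisors hγ
  have htors : Module.IsTorsion (IwasawaAlgebra p) (I.H ⧸ Submodule.span (IwasawaAlgebra p) {s}) :=
    isTorsion_quotient_span_singleton_of_rankOne hrank hκ hγ I hs0
  haveI : Module.Finite (IwasawaAlgebra p) (W.fineSelmerDualData κ hγ).X :=
    FineSelmerDualData.module_finite W κ hγ _
  have hH : Module.lengthAt (IwasawaAlgebra p) (I.H ⧸ Submodule.span (IwasawaAlgebra p) {s}) (primeT p) ≠ ⊤ :=
    lengthAt_primeT_ne_top _ htors
  have hYtors : Module.IsTorsion (IwasawaAlgebra p) (W.fineSelmerDualData κ hγ).X :=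
    IwasawaAlgebra.isTorsion_of_lengthAt_primeT_ne_top _
      (ne_top_of_le_ne_top hH (hlen (primeT p) (height_primeT p)))
  have hchar : Module.charIdeal (IwasawaAlgebra p) (I.H ⧸ Submodule.span (IwasawaAlgebra p) {s}) ≤
      Module.charIdeal (IwasawaAlgebra p) (W.fineSelmerDualData κ hγ).X :=
    Kim2025.charIdeal_le_charIdeal_of_lengthAt_le htors hYtors hlen
  exact natCard_fineSelmer_invariants_dvd_index_of_rankOne W p hrank hκ hγ I J _ e he hYtors s hnt hchar

end Index

end Summit.BirchSwinnertonDyer.BirchSwinnertonDyer.Cruxes.EulerHalfNotRamNoInertSetAtFive.KatoFframe.P1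

end
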